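import Summits.QuantumFields.BalabanUV.Beta.FP.FineHessianLegSplit
import Summits.QuantumFields.BalabanUV.Beta.FP.PerfectPolarization
import Summits.QuantumFields.BalabanUV.Beta.D1BFx.PackedKernelSplit

/-!
# `BalabanUV.Beta.FP.FineHessianGluonCore` — road «FP» for binder row D1, ROW KER-γ (α2) sub-row α2-b PART 2 (owner memo `KER-GAMMA-ALPHA2.md` §3∕§5,
# R-FP-34∕35∕36): THE GLUON CORE OF THE NEAR PIECE — (i) words on an ff-ONLY packed leg (the shape of `Pker`) ARE the words on its ff block,
# UNCONDITIONALLY; (ii) the one-parameter family of unit conventions `fineHessA (c•A) (a•S) ((c·a²)•Wf) = (c²a²)·fineHessA A S Wf`; (iii) the VERTEX SPLIT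
# of the fine Hessian table on a BOUNDED leg; (iv) THE GLUON CORE: `fineHessA (c•P + R) S Wf − (c²a²)·fineHessA P V W = R-WORDS + DEFECT-WORDS`,
# every word displayed, nothing assumed about the defects `D := S − a•V`, `E := Wf − (c·a²)•W`

HONEST DEPENDENCY (page 1, mandatory): continuum YM on T⁴ ⇐ BetaPertH ∧ nine spine estimates (0/9 proved); BetaPertH ⇐ (D1) ∧ (D4) ∧ CAP+tail;
G-an2-4 gates asym, D1 and NE2/3/4.  HONEST FRAMING (cell contract, verbatim): «discharging `BetaPertH` makes Bałaban's UV stability UNCONDITIONAL —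
a real constructive-QFT result; it is NOT the continuum limit and NOT the Clay problem.»  THIS MODULE DISCHARGES NOTHING of the wall: it is [folklore]
kernel bookkeeping (fibre Fubini over `F ⊕ F` under `tsum_congr`; scaling `KernelReflection.comp_smul_left∕right`, `tr_smul`; additivity in a BOUNDED leg
BY NAME over this road's PART 1 `FineHessianLegSplit` (`fineHessA_add_leg_bdd`, `tadpole_add_leg_bdd`) and leaf-02-g9's `KernelReflectionBoundedContact`
(`bubble_add_left_bdd`, `bubble_add_right_bdd`, `comp_add_right_of_slices`, `tr_add_of_summable`)) and ONE [our object] instance (`Pker` is ff-only by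
`PerfectPolarization.Pker_inl_inr∕_inr_inl∕_inr_inr`).  No `def`, no `def … : Prop`, nothing cited, 0 sorry; 0∕4 row-D1 binders; NOT (α2) (the window∕ledger
assembly with `hslice` displayed = PART 3; the MIX identification = α2-a PART 2; the ghost = α2-c), NOT hsplit, NOT (ASYMP), NOT D1, NOT BetaPertH, NOT
continuum, NOT Clay.  «not in print; our bookkeeping».

ABSOLUTE RULE (cell charter, verbatim): «No internally-minted statement may enter as a cited fact. Every hypothesis is either kernel-proved in this package or a
verbatim quotation of a PUBLISHED theorem with page reference. The manuscript(s) under audit are NOT citable for their own disputed steps — they are the thing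
under adjudication; programme-internal (2001/route/tribunal) claims are never citable.»

WHY.  In the near piece `(F m − N⁸·PiBF(s′−s))·𝟙[‖s′−s‖∞ ≤ N]` of the junction (`FineSplitJunctionNearFar`, (ASYMP) of record
`hasym_PiBF_vertex2OfK_of_near_far`), after the fibre split (α2-a PART 1 `FineHessianBlockSplit`) and the slice exchange `hslice` (H′1-KER, displayed in PART 3),
the gluon ff word of the slice table sits on a leg `Γ` and on the literal's ff stencils∕bi-tables `(S, Wf)`, while the comparison `N⁸·wg·(gluon part of PiBF)`
is `N⁸·wg·fineHessA Pker V W` (α2-b PART 0 `FineHessianTransportTable.PiBF_eq_fineHessA`) on the PACKED fibre with an ff-only leg.  §1 puts the comparison on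
the ff fibre without any summability letter; §2 names the unit conventions `(c, a)` under which it is ONE multiple of a fine table (`c²a² = N⁸·wg` is the road's;
the split between `c` and `a` is N0b-S data — DISPLAYED, not chosen); §3–§4 split `Γ = c•P + R` (GAMMA-5 (R1)) and `S = a•V + D`, `Wf = (c·a²)•W + E` and
display the seven words: the four R-WORDS of PART 1 ((G1)(G2) of the memo) and the three DEFECT-WORDS ((G3): in the road `D` = the slice-vertex E-jet words,
`E` = their second-order twins — an identification that is H2V-4's and is NOT made here).

WHAT.  §1 [folklore] `sum_fib_inl` (a fibre sum whose `inr` summands vanish), `comp_ffOnly_inl`∕`comp_ffOnly_inr` (rows of `A ∘ K` for an ff-only `A`),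
**`tadpole_of_ffOnly`**, **`bubble_of_ffOnly`**, **`hessKer_of_ffOnly`**, **`fineHessA_of_ffOnly`** (`D = 4`), and [our object] **`fineHessA_Pker_eq_ff`**;
§2 [folklore] `tadpole_smul_leg`, `bubble_smul_leg`, **`fineHessA_smul`**; §3 [folklore] `tadpole_add_right_bdd`, **`fineHessA_sub_vertex_bdd`**;
§4 [folklore] **`fineHessA_gluonCore`**.
Provenance: road FP OWNER b2b-balaban-beta-d1-p3 gen 10 (prover-b2b-balaban-beta-d1-p3-g10-0), 2026-08-21, sub-row α2-b part 2.
-/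

noncomputable section

namespace Summit.QuantumFields.BalabanUV.Beta.FP.FineHessianGluonCore

open Finset
open scoped BigOperators
open Literature.MathematicalPhysics.QuantumFieldTheory.Balaban1983to89
open Literature.MathematicalPhysics.QuantumFieldTheory.Balaban1983to89.Beta
open ExpKernelCalculus (Site MKer BiLoc comp tr bubble tadpole hessKer)
open KernelWard (Bdd slices_bdd_biLoc biLoc_sub)
open KernelReflection (bubble_smul_left bubble_smul_right tadpole_smul)
open StepJetData (biLoc_smul)
open OneStepResolventKernel (Fib)
open Summit.QuantumFields.BalabanUV.Beta.D1BFx.PackedKernelSplit (inj blk ffV ffW blk_tt)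
open Summit.QuantumFields.BalabanUV.Beta.D1BFx.ContactCount (abs_comp_le_of_entryBound)
open Summit.QuantumFields.BalabanUV.Beta.FP.KernelWardBoundedBricks (summable_trTerm_rl)
open Summit.QuantumFields.BalabanUV.Beta.FP.KernelReflectionBoundedContact (comp_add_right_of_slices tr_add_of_summable bubble_add_left_bdd bubble_add_right_bdd)
open Summit.QuantumFields.BalabanUV.Beta.FP.FineHessianLegSplit (tadpole_add_leg_bdd fineHessA_add_leg_bdd)
open Summit.QuantumFields.BalabanUV.Beta.D1BFx.DressedTablesLeg (tadpoleTableA bubbleTableA tadpoleTableA_apply bubbleTableA_apply)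
open Summit.QuantumFields.BalabanUV.Beta.D1BFx.ReducedKernelSandwichLeg (fineHessA fineHessA_apply)
open Summit.QuantumFields.BalabanUV.Beta.FP.PerfectPolarization (Pker)

variable {D : ℕ} {F : Type*} [Fintype F]

/-! ## §1 Words on an ff-only packed leg are the words on its ff block — unconditionally -/

section FFOnly

variable {A : MKer D (F ⊕ F)}

omit [Fintype F] in
/-- [folklore] entries of an ff-only packed leg with a multiplier column vanish. -/
theorem apply_inl_inr_of_blk (hfm : blk A true false = 0) (x y : Site D) (a b : F) : A x y (Sum.inl a) (Sum.inr b) = 0 := by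
  have h := congrFun (congrFun (congrFun (congrFun hfm x) y) a) b
  simpa [blk, inj] using h

omit [Fintype F] in
/-- [folklore] entries of an ff-only packed leg with a multiplier row vanish (field column). -/
theorem apply_inr_inl_of_blk (hmf : blk A false true = 0) (x y : Site D) (a b : F) : A x y (Sum.inr a) (Sum.inl b) = 0 := by
  have h := congrFun (congrFun (congrFun (congrFun hmf x) y) a) b
  simpa [blk, inj] using h

omit [Fintype F] in
/-- [folklore] entries of an ff-only packed leg with a multiplier row vanish (multiplier column). -/
theorem apply_inr_inr_of_blk (hmm : blk A false false = 0) (x y : Site D) (a b : F) : A x y (Sum.inr a) (Sum.inr b) = 0 := by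
  have h := congrFun (congrFun (congrFun (congrFun hmm x) y) a) b
  simpa [blk, inj] using h

omit [Fintype F] in
/-- [folklore] a multiplier row of an ff-only packed leg vanishes identically. -/
theorem apply_inr_of_blk (hmf : blk A false true = 0) (hmm : blk A false false = 0) (x y : Site D) (a : F) (g : F ⊕ F) :
    A x y (Sum.inr a) g = 0 := by
  cases g with
  | inl b => exact apply_inr_inl_of_blk hmf x y a b
  | inr b => exact apply_inr_inr_of_blk hmm x y a b

/-- [folklore] **FIELD ROW OF `A ∘ K` FOR AN ff-ONLY LEG**: the fibre sum runs over field indices only. -/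
theorem comp_ffOnly_inl (hfm : blk A true false = 0) (K : MKer D (F ⊕ F)) (x z : Site D) (a : F) (g : F ⊕ F) :
    comp A K x z (Sum.inl a) g = ∑' y : Site D, ∑ f : F, A x y (Sum.inl a) (Sum.inl f) * K y z (Sum.inl f) g := by
  unfold ExpKernelCalculus.comp
  refine tsum_congr fun y => ?_
  rw [Fintype.sum_sum_type]
  simp [apply_inl_inr_of_blk hfm]

/-- [folklore] **MULTIPLIER ROW OF `A ∘ K` FOR AN ff-ONLY LEG VANISHES**. -/
theorem comp_ffOnly_inr (hmf : blk A false true = 0) (hmm : blk A false false = 0) (K : MKer D (F ⊕ F)) (x z : Site D) (a : F) (g : F ⊕ F) :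
    comp A K x z (Sum.inr a) g = 0 := by
  unfold ExpKernelCalculus.comp
  simp [apply_inr_of_blk hmf hmm]

/-- [folklore] the ff block of `A ∘ K` for an ff-only leg is `A_ff ∘ K_ff`. -/
theorem comp_ffOnly_inl_inl (hfm : blk A true false = 0) (K : MKer D (F ⊕ F)) (x z : Site D) (a b : F) :
    comp A K x z (Sum.inl a) (Sum.inl b) = comp (blk A true true) (blk K true true) x z a b := by
  rw [comp_ffOnly_inl hfm]
  rfl

/-- [folklore] **THE TADPOLE ON AN ff-ONLY LEG IS THE TADPOLE ON ITS ff BLOCK** — no summability letter. -/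
theorem tadpole_of_ffOnly (hfm : blk A true false = 0) (hmf : blk A false true = 0) (hmm : blk A false false = 0) (W : MKer D (F ⊕ F)) :
    tadpole A W = tadpole (blk A true true) (blk W true true) := by
  unfold ExpKernelCalculus.tadpole ExpKernelCalculus.tr
  refine tsum_congr fun x => ?_
  rw [Fintype.sum_sum_type]
  simp [comp_ffOnly_inr hmf hmm, comp_ffOnly_inl_inl hfm]

/-- [folklore] **THE BUBBLE ON AN ff-ONLY LEG IS THE BUBBLE ON THE ff BLOCKS** — no summability letter. -/
theorem bubble_of_ffOnly (hfm : blk A true false = 0) (hmf : blk A false true = 0) (hmm : blk A false false = 0) (V W : MKer D (F ⊕ F)) :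
    bubble A V W = bubble (blk A true true) (blk V true true) (blk W true true) := by
  unfold ExpKernelCalculus.bubble ExpKernelCalculus.tr
  refine tsum_congr fun x => ?_
  rw [Fintype.sum_sum_type]
  have hrow : ∀ (a : F) (g : F ⊕ F), comp (comp A V) (comp A W) x x (Sum.inr a) g = 0 := by
    intro a g
    show (∑' y : Site D, ∑ h : F ⊕ F, comp A V x y (Sum.inr a) h * comp A W y x h g) = 0
    simp [comp_ffOnly_inr hmf hmm]
  simp only [hrow, Finset.sum_const_zero, add_zero]
  refine Finset.sum_congr rfl fun a _ => ?_
  -- the ff diagonal entry of `(A∘V)∘(A∘W)`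
  show (∑' y : Site D, ∑ g : F ⊕ F, comp A V x y (Sum.inl a) g * comp A W y x g (Sum.inl a)) = _
  refine tsum_congr fun y => ?_
  rw [Fintype.sum_sum_type]
  simp [comp_ffOnly_inr hmf hmm, comp_ffOnly_inl_inl hfm]

/-- [folklore] **THE REDUCED HESSIAN KERNEL ON AN ff-ONLY LEG IS THE KERNEL OF THE ff DATA**: `hessKer A V W = hessKer A_ff (ffV V) (ffW W)`. -/
theorem hessKer_of_ffOnly (hfm : blk A true false = 0) (hmf : blk A false true = 0) (hmm : blk A false false = 0)
    (V : Fin D → Site D → MKer D (F ⊕ F)) (W : Fin D → Site D → Fin D → Site D → MKer D (F ⊕ F)) (μ ν : Fin D) (z : Site D) :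
    hessKer A V W μ ν z = hessKer (blk A true true) (ffV V) (ffW W) μ ν z := by
  simp only [ExpKernelCalculus.hessKer, ffV, ffW, tadpole_of_ffOnly hfm hmf hmm, bubble_of_ffOnly hfm hmf hmm]

end FFOnly

section FFOnlyFour

variable {A : MKer 4 (F ⊕ F)}

/-- [folklore] **THE FINE HESSIAN TABLE ON AN ff-ONLY LEG IS THE TABLE OF THE ff DATA** (`D = 4`). -/
theorem fineHessA_of_ffOnly (hfm : blk A true false = 0) (hmf : blk A false true = 0) (hmm : blk A false false = 0)
    (S : Fin 4 → Site 4 → MKer 4 (F ⊕ F)) (Wf : Fin 4 → Site 4 → Fin 4 → Site 4 → MKer 4 (F ⊕ F)) (κ' l' : Fin 4) (u u' : Site 4) :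
    fineHessA A S Wf κ' l' u u' =
      fineHessA (blk A true true) (fun κ v => blk (S κ v) true true) (fun κ v l v' => blk (Wf κ v l v') true true) κ' l' u u' := by
  rw [fineHessA_apply, fineHessA_apply, tadpoleTableA_apply, tadpoleTableA_apply, bubbleTableA_apply, bubbleTableA_apply,
    tadpole_of_ffOnly hfm hmf hmm, bubble_of_ffOnly hfm hmf hmm]

end FFOnlyFour

/-- [our object] **THE GLUON PART OF `PiBF` LIVES ON THE ff FIBRE**: `Pker` is ff-only (`PerfectPolarization.Pker_inl_inr∕_inr_inl∕_inr_inr`), hence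
`fineHessA Pker V W c e s s′ = fineHessA (blk Pker tt) (V·tt) (W·tt) c e s s′` for ANY packed data `V`, `W`. -/
theorem fineHessA_Pker_eq_ff (V : Fin 4 → Site 4 → MKer 4 (Fib 3)) (W : Fin 4 → Site 4 → Fin 4 → Site 4 → MKer 4 (Fib 3))
    (κ' l' : Fin 4) (u u' : Site 4) :
    fineHessA Pker V W κ' l' u u' =
      fineHessA (blk Pker true true) (fun κ v => blk (V κ v) true true) (fun κ v l v' => blk (W κ v l v') true true) κ' l' u u' :=
  fineHessA_of_ffOnly (by funext x z a b; simp [blk, inj]) (by funext x z a b; simp [blk, inj]) (by funext x z a b; simp [blk, inj]) V W κ' l' u u'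

/-! ## §2 Leg and vertex scaling: the one-parameter family of unit conventions -/

section Scaling

/-- [folklore] **LEG SCALING OF THE TADPOLE**: `tadpole (c•A) W = c·tadpole A W`. -/
theorem tadpole_smul_leg (c : ℝ) (A W : MKer D F) : tadpole (c • A) W = c * tadpole A W := by
  unfold ExpKernelCalculus.tadpole
  rw [KernelReflection.comp_smul_left, KernelReflection.tr_smul]

/-- [folklore] **LEG SCALING OF THE BUBBLE**: `bubble (c•A) V W = c²·bubble A V W`. -/
theorem bubble_smul_leg (c : ℝ) (A V W : MKer D F) : bubble (c • A) V W = c ^ 2 * bubble A V W := by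
  unfold ExpKernelCalculus.bubble
  rw [KernelReflection.comp_smul_left c A V, KernelReflection.comp_smul_left c A W, KernelReflection.comp_smul_left,
    KernelReflection.comp_smul_right, smul_smul, KernelReflection.tr_smul, sq]

/-- [folklore] **THE UNIT CONVENTIONS OF A FINE HESSIAN TABLE**: leg scaled by `c`, first-order stencils by `a`, bi-tables by `c·a²` ⟹ the table scales by `c²a²`:
`fineHessA (c•A) (a•S) ((c·a²)•Wf) κ′ l′ u u′ = (c²a²)·fineHessA A S Wf κ′ l′ u u′`. -/
theorem fineHessA_smul (c a : ℝ) (A : MKer 4 F) (S : Fin 4 → Site 4 → MKer 4 F) (Wf : Fin 4 → Site 4 → Fin 4 → Site 4 → MKer 4 F)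
    (κ' l' : Fin 4) (u u' : Site 4) :
    fineHessA (c • A) (fun κ v => a • S κ v) (fun κ v l v' => (c * a ^ 2) • Wf κ v l v') κ' l' u u'
      = (c ^ 2 * a ^ 2) * fineHessA A S Wf κ' l' u u' := by
  rw [fineHessA_apply, fineHessA_apply, tadpoleTableA_apply, tadpoleTableA_apply, bubbleTableA_apply, bubbleTableA_apply,
    tadpole_smul_leg, tadpole_smul, bubble_smul_leg, bubble_smul_left, bubble_smul_right]
  ring

end Scaling

/-! ## §3 The vertex split on a bounded leg -/

section VertexSplit

/-- [folklore] **THE TADPOLE IS ADDITIVE IN ITS TABLE, BOUNDED LEG**: `tadpole A (W + K) = tadpole A W + tadpole A K` for bounded `A` and bi-localised `W`, `K`. -/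
theorem tadpole_add_right_bdd {A W K : MKer D F} {C Cw Ck δ : ℝ} {p q : Fin D → ℤ} (hA : Bdd A C)
    (hW : BiLoc W p q Cw δ) (hK : BiLoc K p q Ck δ) (hδ : 0 < δ) : tadpole A (W + K) = tadpole A W + tadpole A K := by
  classical
  rcases isEmpty_or_nonempty F with hF | ⟨⟨a₀⟩⟩
  · simp [ExpKernelCalculus.tadpole, ExpKernelCalculus.tr]
  have hC : 0 ≤ C := (abs_nonneg _).trans (hA p p a₀ a₀)
  unfold ExpKernelCalculus.tadpole
  rw [comp_add_right_of_slices (slices_bdd_biLoc hA hW hδ) (slices_bdd_biLoc hA hK hδ)]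
  exact tr_add_of_summable (summable_trTerm_rl (abs_comp_le_of_entryBound hC hA hW hδ) hδ)
    (summable_trTerm_rl (abs_comp_le_of_entryBound hC hA hK hδ) hδ)

/-- [folklore] **THE TADPOLE OF A DIFFERENCE OF TABLES, BOUNDED LEG**. -/
theorem tadpole_sub_right_bdd {A W K : MKer D F} {C Cw Ck δ : ℝ} {p q : Fin D → ℤ} (hA : Bdd A C)
    (hW : BiLoc W p q Cw δ) (hK : BiLoc K p q Ck δ) (hδ : 0 < δ) : tadpole A (W - K) = tadpole A W - tadpole A K := by
  have h := tadpole_add_right_bdd hA (biLoc_sub hW hK) hK hδ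
  rw [sub_add_cancel] at h
  linarith

/-- [folklore] **THE BUBBLE OF A DIFFERENCE IN THE FIRST VERTEX, BOUNDED LEG**. -/
theorem bubble_sub_left_bdd {A V K W : MKer D F} {C Cv Ck Cw δ : ℝ} {p q : Fin D → ℤ} (hA : Bdd A C)
    (hV : BiLoc V p p Cv δ) (hK : BiLoc K p p Ck δ) (hW : BiLoc W q q Cw δ) (hδ : 0 < δ) :
    bubble A (V - K) W = bubble A V W - bubble A K W := by
  have h := bubble_add_left_bdd hA (biLoc_sub hV hK) hK hW hδ
  rw [sub_add_cancel] at h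
  linarith

/-- [folklore] **THE BUBBLE OF A DIFFERENCE IN THE SECOND VERTEX, BOUNDED LEG**. -/
theorem bubble_sub_right_bdd {A V W K : MKer D F} {C Cv Cw Ck δ : ℝ} {p q : Fin D → ℤ} (hA : Bdd A C)
    (hV : BiLoc V p p Cv δ) (hW : BiLoc W q q Cw δ) (hK : BiLoc K q q Ck δ) (hδ : 0 < δ) :
    bubble A V (W - K) = bubble A V W - bubble A V K := by
  have h := bubble_add_right_bdd hA hV (biLoc_sub hW hK) hK hδ
  rw [sub_add_cancel] at h
  linarith

/-- [folklore] **THE VERTEX SPLIT OF THE FINE HESSIAN TABLE ON A BOUNDED LEG** (`D = 4`): for a bounded leg `P`, first-order stencils `S`, `S′` bi-localised at their base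
point and bi-tables `Wf`, `Wf′` bi-localised at their two base points (common rate `δ`),
`fineHessA P S Wf κ′ l′ u u′ − fineHessA P S′ Wf′ κ′ l′ u u′ = ½·tadpole P (Wf κ′ u l′ u′ − Wf′ κ′ u l′ u′) − ½·( bubble P (S κ′ u − S′ κ′ u) (S l′ u′) + bubble P (S′ κ′ u) (S l′ u′ − S′ l′ u′) )`
— the three DEFECT-WORDS, linear in the defects `S − S′`, `Wf − Wf′`. -/
theorem fineHessA_sub_vertex_bdd {P : MKer 4 F} {CP : ℝ} (hP : Bdd P CP)
    {S S' : Fin 4 → Site 4 → MKer 4 F} {Cs Cs' δ : ℝ} (hS : ∀ κ u, BiLoc (S κ u) u u Cs δ) (hS' : ∀ κ u, BiLoc (S' κ u) u u Cs' δ)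
    {Wf Wf' : Fin 4 → Site 4 → Fin 4 → Site 4 → MKer 4 F} {C2 C2' : ℝ}
    (hW : ∀ κ u l u', BiLoc (Wf κ u l u') u u' C2 δ) (hW' : ∀ κ u l u', BiLoc (Wf' κ u l u') u u' C2' δ) (hδ : 0 < δ)
    (κ' l' : Fin 4) (u u' : Site 4) :
    fineHessA P S Wf κ' l' u u' - fineHessA P S' Wf' κ' l' u u' =
      (1 / 2 : ℝ) * tadpole P (Wf κ' u l' u' - Wf' κ' u l' u')
        - (1 / 2 : ℝ) * (bubble P (S κ' u - S' κ' u) (S l' u') + bubble P (S' κ' u) (S l' u' - S' l' u')) := by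
  rw [fineHessA_apply, fineHessA_apply, tadpoleTableA_apply, tadpoleTableA_apply, bubbleTableA_apply, bubbleTableA_apply,
    tadpole_sub_right_bdd hP (hW κ' u l' u') (hW' κ' u l' u') hδ, bubble_sub_left_bdd hP (hS κ' u) (hS' κ' u) (hS l' u') hδ,
    bubble_sub_right_bdd hP (hS' κ' u) (hS l' u') (hS' l' u') hδ]
  ring

end VertexSplit

/-! ## §4 The gluon core -/

section GluonCore

omit [Fintype F] in
/-- [folklore] a scalar multiple of a bounded kernel is bounded. -/
theorem bdd_smul {K : MKer D F} {B : ℝ} (h : Bdd K B) (c : ℝ) : Bdd (c • K) (|c| * B) := by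
  intro x y a b
  show |c * K x y a b| ≤ |c| * B
  rw [abs_mul]
  exact mul_le_mul_of_nonneg_left (h x y a b) (abs_nonneg c)

/-- [folklore] **THE GLUON CORE OF THE NEAR PIECE** (`D = 4`).  Data: a BOUNDED comparison leg `P` (road FP: the ff block of `Pker`), a BOUNDED remainder leg `R`
(road FP: `Γ − c•Pker`, GAMMA-5 (R1)), the literal's ff stencils `S` and bi-tables `Wf`, the comparison data `V`, `W` (road FP: the ff blocks of `PiBF`'s vertex data),
all bi-localised at their base points with a common rate, and two unit constants `c`, `a`.  Then, at every bond pair, with the DEFECTS `D κ v := S κ v − a•V κ v` and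
`E κ v l v′ := Wf κ v l v′ − (c·a²)•W κ v l v′`,
`fineHessA (c•P + R) S Wf − (c²a²)·fineHessA P V W`
`  = [ ½·tadpole R (Wf_{κ′u,l′u′}) − ½·( tr(((c•P)∘S_{κ′u})∘(R∘S_{l′u′})) + tr((R∘S_{κ′u})∘((c•P)∘S_{l′u′})) + bubble R (S κ′ u) (S l′ u′) ) ]`      (R-WORDS, PART 1)
`  + [ ½·tadpole (c•P) (E_{κ′u,l′u′}) − ½·( bubble (c•P) (D κ′ u) (S l′ u′) + bubble (c•P) (a•V κ′ u) (D l′ u′) ) ]`                                  (DEFECT-WORDS, §3)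
— nothing is assumed about `D`, `E`; the seven words are the (G1)(G2)(G3) pieces of `KER-GAMMA-ALPHA2.md` §3 before the window∕ledger assembly. -/
theorem fineHessA_gluonCore {P R : MKer 4 F} {CP CR : ℝ} (hP : Bdd P CP) (hR : Bdd R CR) (c a : ℝ)
    {S V : Fin 4 → Site 4 → MKer 4 F} {Cs Cv δ : ℝ} (hS : ∀ κ u, BiLoc (S κ u) u u Cs δ) (hV : ∀ κ u, BiLoc (V κ u) u u Cv δ)
    {Wf W : Fin 4 → Site 4 → Fin 4 → Site 4 → MKer 4 F} {C2 Cw : ℝ}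
    (hWf : ∀ κ u l u', BiLoc (Wf κ u l u') u u' C2 δ) (hW : ∀ κ u l u', BiLoc (W κ u l u') u u' Cw δ) (hδ : 0 < δ)
    (κ' l' : Fin 4) (u u' : Site 4) :
    fineHessA (c • P + R) S Wf κ' l' u u' - (c ^ 2 * a ^ 2) * fineHessA P V W κ' l' u u' =
      ((1 / 2 : ℝ) * tadpole R (Wf κ' u l' u')
          - (1 / 2 : ℝ) * (tr (comp (comp (c • P) (S κ' u)) (comp R (S l' u'))) + tr (comp (comp R (S κ' u)) (comp (c • P) (S l' u')))
              + bubble R (S κ' u) (S l' u')))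
      + ((1 / 2 : ℝ) * tadpole (c • P) (Wf κ' u l' u' - (c * a ^ 2) • W κ' u l' u')
          - (1 / 2 : ℝ) * (bubble (c • P) (S κ' u - a • V κ' u) (S l' u') + bubble (c • P) (a • V κ' u) (S l' u' - a • V l' u'))) := by
  have hcP : Bdd (c • P) (|c| * CP) := bdd_smul hP c
  have haV : ∀ κ v, BiLoc (a • V κ v) v v (|a| * Cv) δ := fun κ v => biLoc_smul (hV κ v) a
  have hbW : ∀ κ v l v', BiLoc ((c * a ^ 2) • W κ v l v') v v' (|c * a ^ 2| * Cw) δ := fun κ v l v' => biLoc_smul (hW κ v l v') (c * a ^ 2)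
  -- leg split (PART 1) and vertex split (§3) on the leg `c•P`, then the unit conventions (§2)
  have hleg := fineHessA_add_leg_bdd hcP hR hS hWf hδ κ' l' u u'
  have hvert := fineHessA_sub_vertex_bdd hcP hS haV hWf hbW hδ κ' l' u u'
  have hscale := fineHessA_smul c a P V W κ' l' u u'
  rw [← hscale, hleg]
  have e : fineHessA (c • P) S Wf κ' l' u u'
      = fineHessA (c • P) (fun κ v => a • V κ v) (fun κ v l v' => (c * a ^ 2) • W κ v l v') κ' l' u u'
        + ((1 / 2 : ℝ) * tadpole (c • P) (Wf κ' u l' u' - (c * a ^ 2) • W κ' u l' u')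
          - (1 / 2 : ℝ) * (bubble (c • P) (S κ' u - a • V κ' u) (S l' u') + bubble (c • P) (a • V κ' u) (S l' u' - a • V l' u'))) := by
    rw [← hvert]; ring
  rw [e]
  ring

end GluonCore

end Summit.QuantumFields.BalabanUV.Beta.FP.FineHessianGluonCore

end
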